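import Summits.ValiantsHypothesis.ValiantsHypothesis.Theorems.BarrierLeverSuccinctHittingSetsForVPUniversalJoint
import Literature.Computability.AlgebraicComplexity.ValiantClassesProofs

/-!
# Crux `BarrierLever.SuccinctHittingSetsForVP` (stmt-ValiantsHypothesis-14610) — ONE EXPLICIT
# generator family `JointGen.gen n b` on which FSV Question 6 over `ℂ` is decided

Lean text after the cell planner seat `valiant-natproofs-p1` (gen 3, HOME/p1/Chain3.lean §2/§4, the
"refuter target" relayed on the crux item), landed by the prover seat over the TREE's universal
circuit (`RazUniversal.uCoeff` / `outVal`, `UniversalJointSize.jointOut`): the universal generator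
of `…UniversalJoint.exists_jointGenerator` (there `let`-bound inside the proof) as NAMED
DEFINITIONS, so that refuters of Question 6 have one explicit polynomial map to annihilate.
Seeds `Seed n b = Unit ⊕ Σ_{k ≤ n} Lab_k` (a constant coordinate `c₀` and one label block of Raz's
degree-`k` universal circuit-graph of width `wd n b` per degree), numbered by `Fin (q n b)`;
`gen n b m` = Raz's coordinate polynomial `(Γ_{G_k})_m` on the block `k = |m|` (`c₀` for `m = 0`);
`gamma n b = c₀ + Σ_k OUT_k(x, y_k) ∈ ℂ[x ⊕ y]` is its JOINT witness.

* `card_seed_le` (`q ≤ 9376 (n+3)^(5b+21)`); `exists_seed_of_mem` — ONTO `coeff(SmallCircuits ℂ n b)`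
  (Raz 2010 Prop. 3.3 per homogeneous component); `complexity_gamma_le`,
  `totalDegree_seedSpec_gamma_le`, `coeff_seedSpec_gamma` — JOINT succinctness, packaged as
  `jointlySuccinct_gen` (exponent `5b + 23`, `n ≥ 21876 · 2^(5b+21) + 1`) and `into_gen` (INTO
  `coeff(SmallCircuits ℂ n (5b+23))`).
* `fools_gen_of_isSuccinctHittingSet` (onto ⇒ fooling), `isSuccinctHittingSet_of_fools_gen` (into ⇒
  hitting); **`succinctHittingSetsForVP_iff_gen`** — Question 6 over `ℂ` ⟺ `∃ b n₀ ∀ n ≥ n₀`,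
  `gen n b` fools `Distinguishers ℂ n 1`; **`not_succinctHittingSetsForVP_iff_gen`** — ¬ Question 6 ⟺
  for every `b`, infinitely often in `n`, some nonzero level-one `D` has `D ∘ gen n b ≡ 0`;
  `aeval_gen_eq_zero_iff` (meaning of the annihilation); crux-decl form `not_crux_iff_gen`.

WHAT THIS IS NOT: no generator is shown to fool anything unconditionally; not a lower bound;
nothing about hardness. Does NOT close the item.

References: [ForbesShpilkaVolk2018] Lemma 13, Cor. 5, Question 6; [Raz2010] Prop. 2.8, 3.3.
-/

-- layout Summits/ValiantsHypothesis/ValiantsHypothesis forces the duplicated namespace component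
set_option linter.dupNamespace false

noncomputable section

namespace Summit.ValiantsHypothesis.ValiantsHypothesis.Theorems.BarrierLever.SuccinctHittingSetsForVP

open Literature.Barriers.ValiantsHypothesis Literature.Computability.AlgebraicComplexity MvPolynomial
open Generator UniversalJointSize
open Summit.ValiantsHypothesis.ValiantsHypothesis.Theorems.BarrierLever.SuccinctHittingSetsForVP.UniversalJointSize

namespace JointGen

variable (n b : ℕ)

/-! ### The data -/

/-- Size budget of the homogeneous components of a member of `SmallCircuits ℂ n b`. -/
abbrev sz : ℕ := (n + 1) * (n ^ b + n + 2)

/-- Width (slots per level) of the universal circuit-graphs: `4 · sz · (n+1)²`. -/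
abbrev wd : ℕ := 4 * ((n + 1) * (n ^ b + n + 2)) * (n + 1) ^ 2

/-- Labels of Raz's degree-`k` universal circuit-graph of width `wd n b`. -/
abbrev LabK (k : Fin (n + 1)) : Type := RazUniversal.Lab (Fin n) (k : ℕ) (wd n b)

/-- Structured seeds: the constant coordinate `c₀` and one label block per degree `k ≤ n`
(the block `k = 0` is present but unused). -/
abbrev Seed : Type := Unit ⊕ (Σ k : Fin (n + 1), LabK n b k)

/-- Number of seed variables. -/
abbrev q : ℕ := Fintype.card (Seed n b)

/-- The numbering of the structured seeds. -/
abbrev enum : Seed n b ≃ Fin (q n b) := Fintype.equivFin (Seed n b)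

variable {n} in
/-- The degree of a coordinate `m`, as a level `k : Fin (n + 1)`. -/
def lvl (m : degLEMonomials n) : Fin (n + 1) :=
  ⟨(m : Fin n →₀ ℕ).degree, Nat.lt_succ_of_le m.2⟩

/-- The generator on structured seeds: coordinate `m` of degree `k ≥ 1` reads Raz's coordinate
polynomial `(Γ_{G_k})_m` on the block `k`; the coordinate `m = 0` reads `c₀`. -/
def gen₀ (m : degLEMonomials n) : MvPolynomial (Seed n b) ℂ :=
  if (m : Fin n →₀ ℕ).degree = 0 then X (Sum.inl ())
  else rename (fun l : LabK n b (lvl m) => (Sum.inr ⟨lvl m, l⟩ : Seed n b))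
    (RazUniversal.uCoeff ℂ (Fin n) (lvl m : ℕ) (wd n b) (m : Fin n →₀ ℕ))

/-- **The explicit generator** `gen n b : degLEMonomials n → ℂ[y_1, …, y_q]`. -/
def gen (m : degLEMonomials n) : MvPolynomial (Fin (q n b)) ℂ :=
  rename (enum n b) (gen₀ n b m)

/-- Re-indexing of the degree-`k` block into the numbered seeds, on `x ⊕ ·`. -/
def ι (k : Fin (n + 1)) : Fin n ⊕ LabK n b k → Fin n ⊕ Fin (q n b) :=
  Sum.map id fun l => enum n b (Sum.inr ⟨k, l⟩)

/-- The degree-`k` piece `OUT_k(x, y_k)` of the joint witness (void for `k = 0`). -/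
def piece (k : Fin (n + 1)) : MvPolynomial (Fin n ⊕ Fin (q n b)) ℂ :=
  if 1 ≤ (k : ℕ) then rename (ι n b k) (jointOut (Fin n) (k : ℕ) (wd n b)) else 0

/-- **The joint witness** `Γ = c₀ + Σ_{k=1}^{n} OUT_k(x, y_k) ∈ ℂ[x ⊕ y]`. -/
def gamma : MvPolynomial (Fin n ⊕ Fin (q n b)) ℂ :=
  X (Sum.inr (enum n b (Sum.inl ()))) + ∑ k : Fin (n + 1), piece n b k

/-- The degree-`k` value `OUT_k(y_k)` at a structured seed (void for `k = 0`). -/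
def gk (Y : Seed n b → ℂ) (k : Fin (n + 1)) : MvPolynomial (Fin n) ℂ :=
  if 1 ≤ (k : ℕ) then RazUniversal.outVal (fun l : LabK n b k => Y (Sum.inr ⟨k, l⟩)) else 0

/-! ### Parameter count -/

/-- `q n b ≤ 9376 (n+3)^(5b+21)`. [cite: Raz2010, Prop. 2.8 (p. 155)] -/
theorem card_seed_le : q n b ≤ 9376 * (n + 3) ^ (5 * b + 21) := by
  obtain ⟨hb1, -⟩ := bounds n b
  have hlab : ∀ k : Fin (n + 1), Fintype.card (LabK n b k) ≤ 9375 * (n + 3) ^ (5 * b + 20) := by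
    intro k
    refine (RazUniversal.card_lab_le (Fin n) k (wd n b)).trans (le_trans ?_ hb1)
    rw [Fintype.card_fin]
    have hk : (k : ℕ) ≤ n := Nat.lt_succ_iff.mp k.isLt
    gcongr
  have hP : q n b = 1 + ∑ k : Fin (n + 1), Fintype.card (LabK n b k) := by
    simp [Fintype.card_sum, Fintype.card_sigma]
  rw [hP]
  have h1 : 1 ≤ (n + 3) ^ (5 * b + 21) := Nat.one_le_pow _ _ (by omega)
  calc 1 + ∑ k : Fin (n + 1), Fintype.card (LabK n b k)
      ≤ 1 + ∑ _k : Fin (n + 1), 9375 * (n + 3) ^ (5 * b + 20) := by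
        gcongr with k; exact hlab k
    _ = 1 + (n + 1) * (9375 * (n + 3) ^ (5 * b + 20)) := by simp
    _ ≤ 1 + (n + 3) * (9375 * (n + 3) ^ (5 * b + 20)) := by gcongr; omega
    _ = 1 + 9375 * (n + 3) ^ (5 * b + 21) := by ring
    _ ≤ 9376 * (n + 3) ^ (5 * b + 21) := by omega

/-! ### ONTO the class `b` -/

variable {n b}

/-- **ONTO** (Raz 2010 Prop. 3.3 per homogeneous component): every `f ∈ SmallCircuits ℂ n b` is a
value of the generator, `coeff_m f = gen_m(y)` for some seed `y`.
[cite: Raz2010, Prop. 3.3 (p. 158); ForbesShpilkaVolk2018, Lemma 13] -/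
theorem exists_seed_of_mem {f : MvPolynomial (Fin n) ℂ} (hf : f ∈ SmallCircuits ℂ n b) :
    ∃ y : Fin (q n b) → ℂ, ∀ m : degLEMonomials n, eval y (gen n b m) = coeff (m : Fin n →₀ ℕ) f := by
  classical
  have hlabels : ∀ k : Fin (n + 1), ∃ y : LabK n b k → ℂ, 1 ≤ (k : ℕ) →
      ∀ e', eval y (RazUniversal.uCoeff ℂ (Fin n) (k : ℕ) (wd n b) e') =
        coeff e' (homogeneousComponent (k : ℕ) f) := by
    intro k
    by_cases hk : 1 ≤ (k : ℕ)
    · have hg : (homogeneousComponent (k : ℕ) f).IsHomogeneous (k : ℕ) :=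
        homogeneousComponent_isHomogeneous _ _
      have hgc : complexity (homogeneousComponent (k : ℕ) f) ≤ sz n b := by
        have h1 := Summit.ValiantsHypothesis.ValiantsHypothesis.Theorems.DivisionGapZeroOneTransfer.SqrtCheap.complexity_homogeneousComponent_le
          f hf.1 (k : ℕ)
        rw [Fintype.card_fin] at h1
        exact h1.trans (Nat.mul_le_mul_left _ (by have := hf.2; omega))
      have hN : 4 * sz n b * ((k : ℕ) + 1) ^ 2 ≤ wd n b := by
        show 4 * ((n + 1) * (n ^ b + n + 2)) * ((k : ℕ) + 1) ^ 2 ≤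
          4 * ((n + 1) * (n ^ b + n + 2)) * (n + 1) ^ 2
        have hk' : (k : ℕ) ≤ n := Nat.lt_succ_iff.mp k.isLt
        gcongr
      obtain ⟨y, hy⟩ := RazUniversal.exists_eval_uCoeff_eq_coeff (R := ℂ) (σ := Fin n)
        (r := (k : ℕ)) (N := wd n b) (s := sz n b) hk hN hg hgc
      exact ⟨y, fun _ => hy⟩
    · exact ⟨fun _ => 0, fun h => absurd h hk⟩
  choose y hy using hlabels
  let Y : Seed n b → ℂ := Sum.elim (fun _ => coeff 0 f) (fun kl => y kl.1 kl.2)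
  refine ⟨Y ∘ (enum n b).symm, fun m => ?_⟩
  rw [gen, eval_rename, Function.comp_assoc, Equiv.symm_comp_self, Function.comp_id]
  simp only [gen₀]
  split_ifs with h0
  · rw [eval_X]
    have hm0 : (m : Fin n →₀ ℕ) = 0 := (Finsupp.degree_eq_zero_iff _).mp h0
    simp [Y, hm0]
  · rw [eval_rename]
    have hk1 : 1 ≤ ((lvl m : Fin (n + 1)) : ℕ) := Nat.one_le_iff_ne_zero.mpr h0
    have hcomp : Y ∘ (fun l : LabK n b (lvl m) => (Sum.inr ⟨lvl m, l⟩ : Seed n b)) = y (lvl m) := by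
      funext l; simp [Y]
    rw [hcomp, hy (lvl m) hk1]
    simp only [lvl]
    rw [coeff_homogeneousComponent, if_pos rfl]

/-! ### JOINT succinctness of `Γ` -/

variable (n b) in
/-- **Joint size of `Γ`**: `L(Γ) ≤ 21876 (n+3)^(5b+21) + 1`.
[cite: Raz2010, Prop. 2.8; ForbesShpilkaVolk2018, Lemma 13] -/
theorem complexity_gamma_le : complexity (gamma n b) ≤ 21876 * (n + 3) ^ (5 * b + 21) + 1 := by
  obtain ⟨-, hb2⟩ := bounds n b
  have hJc : ∀ k : Fin (n + 1), complexity (piece n b k) ≤ 21875 * (n + 3) ^ (5 * b + 20) := by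
    intro k
    simp only [piece]
    split_ifs
    · refine (complexity_rename_le_holds' _ _).trans ?_
      refine (complexity_jointOut_le_poly (r := (k : ℕ)) (N := wd n b)).trans (le_trans ?_ hb2)
      have hk : (k : ℕ) ≤ n := Nat.lt_succ_iff.mp k.isLt
      show 7 * (n + (k : ℕ) + 4 * ((n + 1) * (n ^ b + n + 2)) * (n + 1) ^ 2 + 1) ^ 5 ≤
        7 * (n + n + 4 * ((n + 1) * (n ^ b + n + 2)) * (n + 1) ^ 2 + 1) ^ 5
      gcongr
    · rw [← C_0, complexity_C_holds]; exact Nat.zero_le _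
  have h1 : 1 ≤ (n + 3) ^ (5 * b + 20) := Nat.one_le_pow _ _ (by omega)
  calc complexity (gamma n b)
      ≤ complexity (X (Sum.inr (enum n b (Sum.inl ()))) : MvPolynomial (Fin n ⊕ Fin (q n b)) ℂ) +
          complexity (∑ k, piece n b k) + 1 := complexity_add_le_holds _ _
    _ ≤ 0 + (∑ k, complexity (piece n b k) + (Finset.univ : Finset (Fin (n + 1))).card) + 1 := by
        rw [complexity_X_holds]
        gcongr
        exact complexity_finset_sum_le _ _
    _ ≤ 0 + (∑ _k : Fin (n + 1), 21875 * (n + 3) ^ (5 * b + 20) +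
          (Finset.univ : Finset (Fin (n + 1))).card) + 1 := by
        gcongr with k; exact hJc k
    _ = (n + 1) * (21875 * (n + 3) ^ (5 * b + 20)) + (n + 1) + 1 := by simp
    _ ≤ (n + 3) * (21875 * (n + 3) ^ (5 * b + 20)) + (n + 3) * (n + 3) ^ (5 * b + 20) + 1 := by
        nlinarith
    _ = 21876 * (n + 3) ^ (5 * b + 21) + 1 := by ring

/-- The values `gk` are homogeneous of degree `k`. -/
theorem isHomogeneous_gk (Y : Seed n b → ℂ) (k : Fin (n + 1)) : (gk n b Y k).IsHomogeneous (k : ℕ) := by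
  simp only [gk]
  split_ifs
  · exact UniversalSize.isHomogeneous_outVal _
  · exact isHomogeneous_zero _ _ _

/-- Seed specialisation of the pieces: `OUT_k(x, y_k)(x, a) = OUT_k(y_k)`. -/
theorem aeval_piece (a : Fin (q n b) → ℂ) (k : Fin (n + 1)) :
    aeval (Sum.elim X fun j => C (a j)) (piece n b k) = gk n b (a ∘ enum n b) k := by
  simp only [piece, gk]
  split_ifs with hk
  · rw [aeval_rename]
    have hfun : ((Sum.elim X fun j => C (a j)) ∘ ι n b k :
        Fin n ⊕ LabK n b k → MvPolynomial (Fin n) ℂ) =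
        Sum.elim X fun l => C ((a ∘ enum n b) (Sum.inr ⟨k, l⟩)) := by
      funext v
      rcases v with t | l <;> rfl
    rw [hfun]
    exact aeval_labels_jointOut _
  · exact map_zero _

/-- **Seed specialisation of `Γ`**: `Γ(x, a) = c₀ + Σ_k OUT_k(y_k)` with `(c₀, y) = a ∘ enum`. -/
theorem seedSpec_gamma (a : Fin (q n b) → ℂ) :
    aeval (Sum.elim X fun j => C (a j)) (gamma n b) =
      C (a (enum n b (Sum.inl ()))) + ∑ k : Fin (n + 1), gk n b (a ∘ enum n b) k := by
  simp only [gamma]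
  rw [map_add, map_sum]
  congr 1
  · rw [aeval_X]
    rfl
  · exact Finset.sum_congr rfl fun k _ => aeval_piece a k

/-- `deg_x Γ(x, a) ≤ n`. -/
theorem totalDegree_seedSpec_gamma_le (a : Fin (q n b) → ℂ) :
    (aeval (Sum.elim X fun j => C (a j)) (gamma n b)).totalDegree ≤ n := by
  rw [seedSpec_gamma]
  refine (totalDegree_add _ _).trans (max_le (by rw [totalDegree_C]; exact Nat.zero_le _) ?_)
  refine totalDegree_finsetSum_le fun k _ => (isHomogeneous_gk _ k).totalDegree_le.trans ?_
  exact Nat.lt_succ_iff.mp k.isLt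

/-- **`gen` is read off `Γ`**: `coeff_m Γ(x, a) = gen_m(a)`. [cite: ForbesShpilkaVolk2018, Lemma 13] -/
theorem coeff_seedSpec_gamma (a : Fin (q n b) → ℂ) (m : degLEMonomials n) :
    coeff (m : Fin n →₀ ℕ) (aeval (Sum.elim X fun j => C (a j)) (gamma n b)) = eval a (gen n b m) := by
  classical
  rw [seedSpec_gamma, gen, eval_rename, coeff_add, coeff_sum, coeff_C]
  set Y : Seed n b → ℂ := a ∘ enum n b with hY
  simp only [gen₀]
  -- only the summand `k = deg m` survives
  have hsum : ∑ k : Fin (n + 1), coeff (m : Fin n →₀ ℕ) (gk n b Y k) =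
      coeff (m : Fin n →₀ ℕ) (gk n b Y (lvl m)) := by
    refine Finset.sum_eq_single (lvl m) (fun k _ hk => ?_) (fun h => absurd (Finset.mem_univ _) h)
    refine (isHomogeneous_gk Y k).coeff_eq_zero ?_
    intro hdeg
    exact hk (Fin.ext (by simp only [lvl]; exact hdeg.symm))
  rw [hsum]
  by_cases h0 : (m : Fin n →₀ ℕ).degree = 0
  · have hm0 : (m : Fin n →₀ ℕ) = 0 := (Finsupp.degree_eq_zero_iff _).mp h0
    rw [if_pos h0, if_pos hm0.symm, eval_X]
    have hlt : ¬ (1 ≤ ((lvl m : Fin (n + 1)) : ℕ)) := by simp only [lvl]; omega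
    have : gk n b Y (lvl m) = 0 := by simp only [gk]; rw [if_neg hlt]
    rw [this, coeff_zero, add_zero]
    rfl
  · have hm0 : (0 : Fin n →₀ ℕ) ≠ (m : Fin n →₀ ℕ) := by
      intro h; apply h0; rw [← h]; simp
    rw [if_neg h0, if_neg hm0, zero_add, eval_rename]
    have hk1 : 1 ≤ ((lvl m : Fin (n + 1)) : ℕ) := Nat.one_le_iff_ne_zero.mpr h0
    have hg : gk n b Y (lvl m) =
        RazUniversal.outVal (fun l : LabK n b (lvl m) => Y (Sum.inr ⟨lvl m, l⟩)) := by
      simp only [gk]; rw [if_pos hk1]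
    rw [hg, RazUniversal.coeff_outVal]
    rfl

/-- **`gen n b` is JOINTLY succinct with exponent `5b + 23`** for `n ≥ 21876 · 2^(5b+21) + 1`
(the body of `JointlySuccinct ℂ n (q n b) (5b+23) (gen n b)`, witnessed by `gamma n b`).
[cite: ForbesShpilkaVolk2018, Lemma 13] -/
theorem jointlySuccinct_gen (hn : 21876 * 2 ^ (5 * b + 21) + 1 ≤ n) :
    ∃ Γ : MvPolynomial (Fin n ⊕ Fin (q n b)) ℂ, complexity Γ ≤ n ^ (5 * b + 23) ∧
      ∀ a : Fin (q n b) → ℂ, (aeval (Sum.elim X fun j => C (a j)) Γ).totalDegree ≤ n ∧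
        ∀ m : degLEMonomials n,
          coeff (m : Fin n →₀ ℕ) (aeval (Sum.elim X fun j => C (a j)) Γ) = eval a (gen n b m) :=
  ⟨gamma n b, (complexity_gamma_le n b).trans (UniversalJoint.size_le_pow b n hn),
    fun a => ⟨totalDegree_seedSpec_gamma_le a, coeff_seedSpec_gamma a⟩⟩

/-- **INTO the class `5b + 23`**: for `n ≥ 21876 · 2^(5b+21) + 1`, every seed output of `gen n b`
is the coefficient vector of a member of `SmallCircuits ℂ n (5b+23)` (namely of `Γ(x, a)`, a
projection of `Γ`).
[cite: ForbesShpilkaVolk2018, Lemma 13] -/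
theorem into_gen (hn : 21876 * 2 ^ (5 * b + 21) + 1 ≤ n) :
    ∀ y : Fin (q n b) → ℂ, ∃ f ∈ SmallCircuits ℂ n (5 * b + 23), ∀ m : degLEMonomials n,
      coeff (m : Fin n →₀ ℕ) f = eval y (gen n b m) := by
  intro y
  refine ⟨aeval (Sum.elim X fun j => C (y j)) (gamma n b), ⟨totalDegree_seedSpec_gamma_le y, ?_⟩,
    coeff_seedSpec_gamma y⟩
  have hproj : IsProjection (aeval (Sum.elim X fun j => C (y j)) (gamma n b)) (gamma n b) := by
    refine ⟨Sum.elim X fun j => C (y j), fun i => ?_, rfl⟩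
    cases i with
    | inl i => exact Or.inl ⟨i, rfl⟩
    | inr j => exact Or.inr ⟨y j, rfl⟩
  exact (complexity_le_of_isProjection hproj).trans
    ((complexity_gamma_le n b).trans (UniversalJoint.size_le_pow b n hn))

/-! ### Fooling, from and to hitting -/

/-- **ONTO ⇒ fooling**: if `SmallCircuits ℂ n b` hits `Distinguishers ℂ n a`, then `gen n b` fools
level `a`: no nonzero level-`a` distinguisher annihilates it. [cite: ForbesShpilkaVolk2018, Thm. 4, Cor. 5] -/
theorem fools_gen_of_isSuccinctHittingSet {a : ℕ}
    (hhit : IsSuccinctHittingSet (degLEMonomials n) (SmallCircuits ℂ n b) (Distinguishers ℂ n a)) :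
    ∀ D ∈ Distinguishers ℂ n a, D ≠ 0 → aeval (gen n b) D ≠ 0 := by
  intro D hD hD0 h0
  obtain ⟨f, hf, hne⟩ := hhit D hD hD0
  obtain ⟨y, hy⟩ := exists_seed_of_mem hf
  have hpt : coeffVector (degLEMonomials n) f = fun m => eval y (gen n b m) := by
    funext m
    rw [coeffVector_apply, hy m]
  rw [hpt, Generator.eval_point_eq, h0, map_zero] at hne
  exact hne rfl

/-- **INTO ⇒ hitting**: if `gen n b` fools level `a` (and `n ≥ 21876 · 2^(5b+21) + 1`), then
`SmallCircuits ℂ n (5b+23)` hits `Distinguishers ℂ n a`. [cite: ForbesShpilkaVolk2018, Lemma 13] -/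
theorem isSuccinctHittingSet_of_fools_gen {a : ℕ} (hn : 21876 * 2 ^ (5 * b + 21) + 1 ≤ n)
    (hfool : ∀ D ∈ Distinguishers ℂ n a, D ≠ 0 → aeval (gen n b) D ≠ 0) :
    IsSuccinctHittingSet (degLEMonomials n) (SmallCircuits ℂ n (5 * b + 23)) (Distinguishers ℂ n a) := by
  intro D hD hD0
  obtain ⟨y, hy⟩ := Generator.exists_eval_ne_zero (hfool D hD hD0)
  obtain ⟨f, hf, hcoeff⟩ := into_gen hn y
  refine ⟨f, hf, ?_⟩
  have hpt : coeffVector (degLEMonomials n) f = fun m => eval y (gen n b m) := by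
    funext m
    rw [coeffVector_apply, hcoeff m]
  rwa [hpt, Generator.eval_point_eq]

/-! ### Question 6 on the one explicit family -/

/-- **FSV Question 6 over `ℂ` on ONE explicit family**: `SuccinctHittingSetsForVP ℂ` holds iff for
some `b`, eventually in `n`, the explicit generator `gen n b` fools the level-one distinguishers.
(⇒: onto, with the `b` of the hypothesis at level `1`; ⇐: into, class `5b + 23`, then the level knob
is inert — `succinctHittingSetsForVP_iff_levelOne`.) [cite: ForbesShpilkaVolk2018, Lemma 13, Cor. 5, Question 6] -/
theorem succinctHittingSetsForVP_iff_gen :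
    SuccinctHittingSetsForVP ℂ ↔
      ∃ b n₀ : ℕ, ∀ n : ℕ, n₀ ≤ n → ∀ D ∈ Distinguishers ℂ n 1, D ≠ 0 → aeval (gen n b) D ≠ 0 := by
  constructor
  · intro h
    obtain ⟨b, n₀, hhit⟩ := h 1
    exact ⟨b, n₀, fun n hn => fools_gen_of_isSuccinctHittingSet (hhit n hn)⟩
  · rintro ⟨b, n₀, hfool⟩
    have key : Summit.ValiantsHypothesis.ValiantsHypothesis.Theses.BarrierLever.SuccinctHittingSetsForVP :=
      succinctHittingSetsForVP_iff_generator.mpr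
        ⟨5 * b + 23, max n₀ (21876 * 2 ^ (5 * b + 21) + 1), fun n hn =>
          ⟨q n b, gen n b, into_gen ((le_max_right _ _).trans hn),
            hfool n ((le_max_left _ _).trans hn)⟩⟩
    exact key

/-- **¬ Question 6 on ONE explicit family** (the refuter target): algebraically natural proofs
against `VP` exist in the FSV sense — for EVERY size exponent `b`, infinitely often in `n` — iff for
every `b` and `n₀` there are `n ≥ n₀` and a nonzero level-one distinguisher `D` with
`D ∘ gen n b ≡ 0` identically in the seed variables. [cite: ForbesShpilkaVolk2018, Question 6] -/
theorem not_succinctHittingSetsForVP_iff_gen :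
    ¬ SuccinctHittingSetsForVP ℂ ↔
      ∀ b n₀ : ℕ, ∃ n : ℕ, n₀ ≤ n ∧ ∃ D ∈ Distinguishers ℂ n 1, D ≠ 0 ∧ aeval (gen n b) D = 0 := by
  rw [succinctHittingSetsForVP_iff_gen]
  simp only [not_exists, not_forall, ne_eq, exists_prop, not_not]

/-- Meaning of the annihilation over `ℂ`: `D ∘ gen n b ≡ 0` as a polynomial in the seeds iff `D`
vanishes at the coefficient vector of EVERY seed specialisation `Γ(x, a)` of the joint witness. -/
theorem aeval_gen_eq_zero_iff (D : MvPolynomial (degLEMonomials n) ℂ) :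
    aeval (gen n b) D = 0 ↔
      ∀ a : Fin (q n b) → ℂ,
        eval (coeffVector (degLEMonomials n) (aeval (Sum.elim X fun j => C (a j)) (gamma n b))) D = 0 := by
  have hcv : ∀ a : Fin (q n b) → ℂ,
      coeffVector (degLEMonomials n) (aeval (Sum.elim X fun j => C (a j)) (gamma n b)) =
        fun m => eval a (gen n b m) := by
    intro a
    funext m
    rw [coeffVector_apply]
    exact coeff_seedSpec_gamma a m
  refine ⟨fun h a => by rw [hcv a, Generator.eval_point_eq, h, map_zero], fun h => ?_⟩
  exact MvPolynomial.funext fun a => by rw [← Generator.eval_point_eq, ← hcv a, h a, map_zero]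

/-- The refuter's form against the crux decl: `¬ Theses.BarrierLever.SuccinctHittingSetsForVP` ⟺
for every `b`, infinitely often, a nonzero level-one distinguisher annihilates `gen n b`. -/
theorem not_crux_iff_gen :
    ¬ Summit.ValiantsHypothesis.ValiantsHypothesis.Theses.BarrierLever.SuccinctHittingSetsForVP ↔
      ∀ b n₀ : ℕ, ∃ n : ℕ, n₀ ≤ n ∧ ∃ D ∈ Distinguishers ℂ n 1, D ≠ 0 ∧ aeval (gen n b) D = 0 :=
  not_succinctHittingSetsForVP_iff_gen

end JointGen

end Summit.ValiantsHypothesis.ValiantsHypothesis.Theorems.BarrierLever.SuccinctHittingSetsForVP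

end
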